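import Literature.MathematicalPhysics.QuantumFieldTheory.Balaban1983to89.T4OutputRate
import Summits.QuantumFields.BalabanUV.T4Continuum.Support.NE7MarginalL1Currency

/-!
# T⁴ programme, spine estimate NE9 (node U3, history side) — SUMMABLE (non-geometric) MEMORY: what it still gives
# (a creation-step-UNIFORM coupling bracket; an ℓ¹ bracket; node U6's `Summable δ`) and what it does NOT give
# (no geometric rate, hence no `T4CauchySum.InjectedRate`) — census item of cell `pub-balaban-gaps`, seat ne9

Cell `pub-balaban-gaps` (YM blitz G2, seat ne9, unit `pub-balaban-gaps-ne9-g2`; record `run/shared/lean/pub/pub-balaban-gaps/ne/NE9.md`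
§5 rows C6 ∕ C17).  Summits-side bookkeeping over the Literature SHAPES `T4OutputRate.NE9` ∕ `T4OutputRate.FadingMemory` and node U6's
`T4CauchySum.delta`; nothing of the row's `Support/NE9*` modules is imported or edited (the two convolution lemmas of the NE7 crux's
ℓ¹-currency leaf `NE7MarginalL1Currency` are used BY NAME).

WHY.  The REPAIR CENSUS of NE9 (joint Lipschitz dependence of Bałaban's scale-`j` term `E^{(j)}(X; g⃗, U)` on the coupling history with
FADING-MEMORY moduli `Λ j i ≤ C₉·ω^{j−i}`, `ω < 1`) asks what happens if the geometric fading is WEAKENED to a merely SUMMABLE age profile,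
`0 ≤ Λ k i ≤ λ(k − i)` with `Σ_n λ(n) < ∞` (row C6 of the record, there decided in prose).  This file settles the item in the kernel:
* what SURVIVES — (i) the node-U5b structural claim «the influence of old couplings does not accumulate»: under a uniform coupling
  discrepancy `|g^A_i − g^B_i| ≤ D` the history bracket is `≤ (Σ_n λ(n))·D` UNIFORMLY in the creation step (`historySum_le_tsum_mul`,
  generalising `T4OutputRate.historySum_le_of_fadingMemory`, whose constant `C₉D(1−ω)⁻¹` is the geometric sum); (ii) against a SUMMABLE
  discrepancy profile `|g^A_i − g^B_i| ≤ d_i`, `Σ d_i < ∞`, the bracket majorant `j ↦ Σ_{i<j} λ(j−i)·d_i` is itself summable over the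
  creation steps (`summable_bracketMajorant`, a Cauchy product), and node U6's Cauchy sum consumes exactly that: an injection dominated by
  ANY summable scale profile, `0 ≤ inj K j ≤ r_j`, has `Summable (delta E ρ inj)` (`summable_delta_of_scaleProfile`);
* what is LOST — the RATE: already against the geometric discrepancy profile `d = 𝟙_{i=0} ≤ (½)^i` the summable profile
  `λ(n) = (n+1)⁻²` produces the bracket `(j+1)⁻²`, which is below NO `C·θ^j` with `θ < 1` (`exists_summableMemory_no_geometric_rate`) and
  is NOT a `T4CauchySum.InjectedRate C c θ` for any constants, the asymptotic-freedom slack `(K+1)^c` notwithstanding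
  (`not_injectedRate_of_witness`).  So the spine's TYPED currency between nodes U3 and U6 — `T4OutputRate.u3_geometric` (bracket
  `≤ b·θ^j`), the same-rate ∕ rate-loss fixed points of `T4CouplingMatching` ∕ `T4CurrencyMatching`, `T4CauchySum.InjectedRate`, and the
  log-window weight `T4GoodClassBudget.windowSum θ Λ` of the closure of record `T4MatchingClosure.stringHybridNE7_closure`, all typed on
  GEOMETRIC scale rates `θ^j` — cannot carry summable memory AS TYPED, while U6's bare socket `Summable δ` can.  For the classification
  of NE9 this is NEUTRAL: Bałaban's mechanism (per-step transfer × contraction of irrelevant terms, `T4CouplingAnalyticity.StepTransfer`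
  ⇒ `geomMod`, `T4HistoryLipschitzRecursion.prodModuli`) produces GEOMETRIC moduli or none (`sticky_not_fadingMemory`); no sub-geometric
  fading arises from it, and the smallness clause N2 (`rate < 1`) is untouched.

WHAT IS PROVED (kernel; elementary real analysis, `[folklore]`): `fadingMemory_iff_ageProfile` (geometric fading IS the age profile
`n ↦ C₉ω^n`), `historySum_le_conv`, `historySum_le_tsum_mul`, `summable_bracketMajorant`, `ne9_bracket_of_ageProfile` (NE9 + a summable
age profile + a summable discrepancy profile ⇒ the scale-`j` difference is `≤ e^{−κd_j(X)}·b_j` with `Σ_j b_j < ∞`), `delta_le_scaleProfile`,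
`summable_delta_of_scaleProfile`, `witnessBracket_eq`, `exists_summableMemory_no_geometric_rate`, `not_injectedRate_of_witness`, `summable_delta_witness`.

HONEST FRAMING: bookkeeping for rung (B)+1 on a FIXED finite four-torus; facts about the SHAPE of NE9 and the socket of node U6, not about
Bałaban's functionals; NE9 is NOT PRINTED ([Balaban1987RG1] p. 263 gives only *"It is a C^∞-function of g_{j−1} ∈ [0, γ], (or analytic)"*
and p. 256 ∕ p. 298 the existence of the dependence on all preceding couplings) and NOT PROVED; spine PROVED 0∕9 unchanged; NOT UV
stability, NOT the continuum limit, NOT infinite volume, NOT a mass gap, NOT Clay.  HONEST DEPENDENCY: continuum YM on T⁴ ⇐ BetaPertH ∧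
nine spine estimates (0∕9 proved); BetaPertH ⇐ (D1) ∧ (D4) ∧ CAP+tail.

References (TYPES only): [Balaban1987RG1] = T. Bałaban, Commun. Math. Phys. **109** (1987) 249–301, p. 256, p. 263, p. 298;
[King1986] = C. King, Commun. Math. Phys. **102** (1986) 649–677, (3.9) p. 656 (the printed template of a geometric scale rate).
-/

namespace Summit.QuantumFields.BalabanUV.T4Continuum.NE9.SummableMemory

open scoped BigOperators
open Finset Filter Topology
open Literature.MathematicalPhysics.QuantumFieldTheory.Balaban1983to89
open Literature.MathematicalPhysics.QuantumFieldTheory.Balaban1983to89.T4OutputRate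
open T4CauchySum (delta InjectedRate)
open Summit.QuantumFields.BalabanUV.T4Continuum.NE7MarginalL1Currency (summable_conv summable_conv_geometric)

variable {C : Carriers} {Bg : Type}

/-! ## §1 Age profiles: geometric fading is the profile `n ↦ C₉·ω^n` -/

/-- `FadingMemory C₉ ω Λ` IS the statement that the moduli sit under the AGE PROFILE `n ↦ C₉·ω^n` (definitional unfolding; recorded so
that every theorem below, stated for a general profile `λ`, specialises to the spine's shape by `rfl`). [folklore] -/
theorem fadingMemory_iff_ageProfile {C₉ ω : ℝ} {Λ : ℕ → ℕ → ℝ} :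
    FadingMemory C₉ ω Λ ↔ ∀ k i, i ≤ k → 0 ≤ Λ k i ∧ Λ k i ≤ (fun n : ℕ => C₉ * ω ^ n) (k - i) :=
  Iff.rfl

/-! ## §2 The coupling bracket under an age profile -/

/-- Under an age profile `0 ≤ Λ k i ≤ λ(k − i)` and a discrepancy profile `|g^A_i − g^B_i| ≤ d_i`, node U3's coupling bracket at creation
step `j` is dominated by the CONVOLUTION `Σ_{i<j} λ(j − i)·d_i`. [folklore] -/
theorem historySum_le_conv {lam : ℕ → ℝ} {Λ : ℕ → ℕ → ℝ}
    (hΛ : ∀ k i, i ≤ k → 0 ≤ Λ k i ∧ Λ k i ≤ lam (k - i))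
    {gA gB : ℕ → ℝ} {d : ℕ → ℝ} (hd : ∀ i, |gA i - gB i| ≤ d i) (j : ℕ) :
    ∑ i ∈ range j, Λ j i * |gA i - gB i| ≤ ∑ i ∈ range j, lam (j - i) * d i := by
  refine sum_le_sum fun i hi => ?_
  obtain ⟨h0, h1⟩ := hΛ j i (mem_range.mp hi).le
  exact mul_le_mul h1 (hd i) (abs_nonneg _) (h0.trans h1)

/-- **SUMMABLE MEMORY STILL GIVES A CREATION-STEP-UNIFORM BRACKET.**  Under a nonnegative SUMMABLE age profile `λ` and a UNIFORM coupling
discrepancy `|g^A_i − g^B_i| ≤ D`, the history bracket is `≤ (Σ_n λ(n))·D` for every creation step `j` — the structural claim of node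
U5b («the influence of old couplings does not accumulate over scales») survives the weakening of geometric fading to summable fading;
`T4OutputRate.historySum_le_of_fadingMemory` is the case `λ(n) = C₉ω^n`, `Σ_n λ(n) = C₉(1−ω)⁻¹`. [folklore] -/
theorem historySum_le_tsum_mul {lam : ℕ → ℝ} {Λ : ℕ → ℕ → ℝ}
    (hΛ : ∀ k i, i ≤ k → 0 ≤ Λ k i ∧ Λ k i ≤ lam (k - i))
    (hlam0 : ∀ n, 0 ≤ lam n) (hlam : Summable lam)
    {gA gB : ℕ → ℝ} {D : ℝ} (hD : ∀ i, |gA i - gB i| ≤ D) (j : ℕ) :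
    ∑ i ∈ range j, Λ j i * |gA i - gB i| ≤ (∑' n, lam n) * D := by
  have hD0 : 0 ≤ D := (abs_nonneg _).trans (hD 0)
  have h1 := historySum_le_conv hΛ (d := fun _ => D) hD j
  have hrefl : ∑ i ∈ range j, lam (j - i) = ∑ m ∈ range j, lam (m + 1) := by
    rw [← sum_range_reflect (fun m => lam (m + 1)) j]
    refine sum_congr rfl fun i hi => ?_
    rw [mem_range] at hi
    congr 1
    omega
  have hshift : Summable (fun m => lam (m + 1)) := (summable_nat_add_iff 1).mpr hlam
  have htail : ∑ m ∈ range j, lam (m + 1) ≤ ∑' n, lam n := by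
    have hle : ∑ m ∈ range j, lam (m + 1) ≤ ∑' m, lam (m + 1) :=
      sum_le_hasSum _ (fun m _ => hlam0 _) hshift.hasSum
    have hsplit := hlam.sum_add_tsum_nat_add 1
    have h0 : 0 ≤ ∑ i ∈ range 1, lam i := sum_nonneg fun i _ => hlam0 i
    linarith
  calc ∑ i ∈ range j, Λ j i * |gA i - gB i| ≤ ∑ i ∈ range j, lam (j - i) * D := h1
    _ = D * ∑ i ∈ range j, lam (j - i) := by
        rw [mul_sum]
        exact sum_congr rfl fun i _ => mul_comm _ _
    _ ≤ D * ∑' n, lam n := mul_le_mul_of_nonneg_left (hrefl ▸ htail) hD0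
    _ = (∑' n, lam n) * D := mul_comm _ _

/-- **THE BRACKET MAJORANT IS ℓ¹.**  For nonnegative summable `λ` and `d`, the convolution majorant `j ↦ Σ_{i<j} λ(j − i)·d_i` of the
coupling bracket is summable over the creation steps (a Cauchy product; `NE7MarginalL1Currency.summable_conv` BY NAME). [folklore] -/
theorem summable_bracketMajorant {lam d : ℕ → ℝ} (hlam0 : ∀ n, 0 ≤ lam n) (hlam : Summable lam)
    (hd0 : ∀ i, 0 ≤ d i) (hd : Summable d) :
    Summable (fun j => ∑ i ∈ range j, lam (j - i) * d i) := by
  have hc := summable_conv hd hd0 hlam hlam0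
  refine Summable.of_nonneg_of_le (fun j => sum_nonneg fun i _ => mul_nonneg (hlam0 _) (hd0 _)) (fun j => ?_) hc
  calc ∑ i ∈ range j, lam (j - i) * d i ≤ ∑ i ∈ range (j + 1), lam (j - i) * d i :=
        sum_le_sum_of_subset_of_nonneg (range_mono (Nat.le_succ j))
          (fun i _ _ => mul_nonneg (hlam0 _) (hd0 _))
    _ = ∑ l ∈ range (j + 1), d l * lam (j - l) := sum_congr rfl fun i _ => mul_comm _ _

/-- **NE9 UNDER A SUMMABLE AGE PROFILE, END TO END AT NODE U3.**  `NE9 E W κ Λ` with moduli under a nonnegative summable age profile `λ`,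
and two admissible coupling sequences whose discrepancies sit under a summable profile `d`: the scale-`j` term difference is
`≤ e^{−κd_j(X)}·b_j` with the EXPLICIT majorant `b_j = Σ_{i<j} λ(j−i)·d_i`, and `Σ_j b_j < ∞`.  (What it is NOT: a geometric rate in `j` —
§4.) [folklore] -/
theorem ne9_bracket_of_ageProfile {E : Functional C Bg} {W : Set (ℕ → ℝ)} {κ : ℝ} {Λ : ℕ → ℕ → ℝ} {lam d : ℕ → ℝ}
    (h9 : NE9 E W κ Λ) (hΛ : ∀ k i, i ≤ k → 0 ≤ Λ k i ∧ Λ k i ≤ lam (k - i))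
    (hlam0 : ∀ n, 0 ≤ lam n) (hlam : Summable lam)
    {gA gB : ℕ → ℝ} (hgA : gA ∈ W) (hgB : gB ∈ W) (hd : ∀ i, |gA i - gB i| ≤ d i) (hdsum : Summable d) :
    (∀ (U : Bg) (X : C.Dom), |E gA U X - E gB U X|
        ≤ Real.exp (-(κ * C.d X)) * ∑ i ∈ range (C.scale X), lam (C.scale X - i) * d i)
      ∧ Summable (fun j => ∑ i ∈ range j, lam (j - i) * d i) := by
  refine ⟨fun U X => ?_, summable_bracketMajorant hlam0 hlam (fun i => (abs_nonneg _).trans (hd i)) hdsum⟩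
  exact (h9 gA hgA gB hgB U X).trans
    (mul_le_mul_of_nonneg_left (historySum_le_conv hΛ hd _) (Real.exp_pos _).le)

/-! ## §3 Node U6 consumes a summable scale profile -/

/-- An injection dominated by a scale profile `r` (`0 ≤ inj K j ≤ r_j`, uniformly in the cutoff `K`) has transported total
`delta E ρ inj K ≤ E·Σ_{j≤K} r_j ρ^{K−j}` — the geometric convolution of the profile. [folklore] -/
theorem delta_le_scaleProfile {E ρ : ℝ} {r : ℕ → ℝ} {inj : ℕ → ℕ → ℝ} (hE : 0 ≤ E) (hρ : 0 ≤ ρ)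
    (hinj : ∀ K j : ℕ, j ≤ K → 0 ≤ inj K j ∧ inj K j ≤ r j) (K : ℕ) :
    delta E ρ inj K ≤ E * ∑ j ∈ range (K + 1), r j * ρ ^ (K - j) := by
  unfold delta
  refine mul_le_mul_of_nonneg_left ?_ hE
  rw [← Nat.sum_antidiagonal_eq_sum_range_succ (fun j n => r j * ρ ^ n) K]
  refine sum_le_sum fun p hp => ?_
  have hj : p.1 ≤ K := by have := mem_antidiagonal.mp hp; omega
  exact mul_le_mul_of_nonneg_right (hinj K p.1 hj).2 (pow_nonneg hρ _)

/-- **`Σ_K δ_K < ∞` FROM ANY SUMMABLE SCALE PROFILE** (no geometric rate, no polynomial cutoff factor): `0 ≤ E`, `0 ≤ ρ < 1`, a nonnegative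
summable `r` and an injection dominated by it give `Summable (delta E ρ inj)` — node U6's socket (`T4CauchySum.cauchySum` needs only
this summability downstream of `delta`).  Compare `T4CauchySum.summable_delta` (geometric `InjectedRate`) and the NE7 leaf's
`CauchySumPinnedConvolution.summable_delta_of_pinned_summable` (IR-pinned tails). [folklore] -/
theorem summable_delta_of_scaleProfile {E ρ : ℝ} {r : ℕ → ℝ} {inj : ℕ → ℕ → ℝ} (hE : 0 ≤ E) (hρ : 0 ≤ ρ) (hρ1 : ρ < 1)
    (hr0 : ∀ j, 0 ≤ r j) (hr : Summable r) (hinj : ∀ K j : ℕ, j ≤ K → 0 ≤ inj K j ∧ inj K j ≤ r j) :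
    Summable (delta E ρ inj) := by
  refine Summable.of_nonneg_of_le (fun K => ?_) (fun K => delta_le_scaleProfile hE hρ hinj K)
    ((summable_conv_geometric hr hr0 hρ hρ1).mul_left E)
  unfold delta
  refine mul_nonneg hE (sum_nonneg fun p hp => ?_)
  have hj : p.1 ≤ K := by have := mem_antidiagonal.mp hp; omega
  exact mul_nonneg (hinj K p.1 hj).1 (pow_nonneg hρ _)

/-! ## §4 What summable memory does NOT give: a rate -/

/-- The witness bracket: with `λ(n) = (n+1)⁻²` and `d = 𝟙_{i=0}`, the convolution majorant at a creation step `j ≥ 1` is exactly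
`(j+1)⁻²`. [folklore] -/
theorem witnessBracket_eq {j : ℕ} (hj : 1 ≤ j) :
    ∑ i ∈ range j, (1 / (((j - i : ℕ) : ℝ) + 1) ^ 2) * (if i = 0 then (1 : ℝ) else 0) = 1 / ((j : ℝ) + 1) ^ 2 := by
  rw [sum_eq_single 0]
  · simp
  · intro i _ hi
    simp [hi]
  · intro h
    exact absurd (mem_range.mpr hj) h

/-- **SUMMABLE MEMORY YIELDS NO GEOMETRIC RATE.**  There are a nonnegative SUMMABLE age profile `λ` (namely `(n+1)⁻²`) and a discrepancy
profile `d` that is even GEOMETRICALLY small (`d = 𝟙_{i=0} ≤ (½)^i`, summable) such that the bracket majorant `Σ_{i<j} λ(j−i)d_i` lies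
below NO geometric envelope: for every `C` and every `0 ≤ θ < 1` some creation step has `C·θ^j < Σ_{i<j} λ(j−i)d_i`.  Hence neither
`T4OutputRate.u3_geometric` (which asks the bracket `≤ b·θ^j`) nor any same-rate∕rate-loss fixed point of node U2 can be fed by
summable memory: the weakening of row C6 leaves the spine's typed currency exactly at node U6's bare socket (§3). [folklore] -/
theorem exists_summableMemory_no_geometric_rate :
    ∃ lam d : ℕ → ℝ, (∀ n, 0 ≤ lam n) ∧ Summable lam ∧ (∀ i, 0 ≤ d i) ∧ (∀ i, d i ≤ (1 / 2 : ℝ) ^ i) ∧ Summable d ∧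
      ∀ Cr θ : ℝ, 0 ≤ θ → θ < 1 → ∃ j : ℕ, Cr * θ ^ j < ∑ i ∈ range j, lam (j - i) * d i := by
  -- the p-series shifted off zero (kept local: the tree holds this fact under other summits' names)
  have hps : Summable (fun n : ℕ => 1 / ((n : ℝ) + 1) ^ 2) := by
    have h1 := (summable_nat_add_iff 1).mpr (Real.summable_one_div_nat_pow.mpr (by norm_num : 1 < 2))
    exact h1.congr fun n => by push_cast; rfl
  refine ⟨fun n => 1 / ((n : ℝ) + 1) ^ 2, fun i => if i = 0 then (1 : ℝ) else 0, fun n => by positivity,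
    hps, fun i => ?_, fun i => ?_, ?_, fun Cr θ hθ hθ1 => ?_⟩
  · by_cases hi : i = 0 <;> simp [hi]
  · by_cases hi : i = 0
    · subst hi; simp
    · simp only [hi, if_false]; positivity
  · exact summable_of_ne_finset_zero (s := {0}) fun i hi => by
      rw [mem_singleton] at hi
      simp [hi]
  · -- polynomial × geometric → 0: eventually 4|C|·j²θ^j < 1, and (j+1)² ≤ 4j² for j ≥ 1
    have ht : Tendsto (fun n : ℕ => 4 * |Cr| * ((n : ℝ) ^ 2 * θ ^ n)) atTop (𝓝 0) := by
      have := (tendsto_pow_const_mul_const_pow_of_lt_one 2 hθ hθ1).const_mul (4 * |Cr|)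
      simpa using this
    have hev : ∀ᶠ n : ℕ in atTop, 4 * |Cr| * ((n : ℝ) ^ 2 * θ ^ n) < 1 := ht.eventually (gt_mem_nhds one_pos)
    obtain ⟨N, hN⟩ := eventually_atTop.mp hev
    refine ⟨max N 1, ?_⟩
    have hjN : N ≤ max N 1 := le_max_left _ _
    have hj1 : 1 ≤ max N 1 := le_max_right _ _
    have hlt := hN _ hjN
    rw [witnessBracket_eq hj1]
    set j : ℕ := max N 1
    have hθj : 0 ≤ θ ^ j := pow_nonneg hθ j
    have hjr : (1 : ℝ) ≤ j := by exact_mod_cast hj1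
    have hjj : ((j : ℝ) + 1) ^ 2 ≤ 4 * (j : ℝ) ^ 2 := by nlinarith
    have hpos : 0 < ((j : ℝ) + 1) ^ 2 := by positivity
    rw [lt_div_iff₀ hpos]
    calc Cr * θ ^ j * ((j : ℝ) + 1) ^ 2 ≤ |Cr| * θ ^ j * (4 * (j : ℝ) ^ 2) :=
          mul_le_mul (mul_le_mul_of_nonneg_right (le_abs_self Cr) hθj) hjj hpos.le
            (mul_nonneg (abs_nonneg _) hθj)
      _ = 4 * |Cr| * ((j : ℝ) ^ 2 * θ ^ j) := by ring
      _ < 1 := hlt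

/-- **… AND NO `InjectedRate`, THE ASYMPTOTIC-FREEDOM SLACK NOTWITHSTANDING.**  The witness bracket `(j+1)⁻²` (`j ≥ 1`; `1` at `j = 0`),
read as a cutoff-independent injection `inj K j`, is NOT a `T4CauchySum.InjectedRate C c θ` for ANY constant `C`, ANY polynomial
exponent `c` and ANY `0 ≤ θ < 1` — at the diagonal `j = K` one would need `(K+1)⁻² ≤ C(K+1)^cθ^K`.  Yet by §3 the same injection has
`Summable (delta E ρ ·)` for every `0 ≤ ρ < 1` (profile `r_j = (j+1)⁻²`, resp. `1`): node U6's socket is strictly wider than the spine's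
typed currency between U3 and U6. [folklore] -/
theorem not_injectedRate_of_witness (Cc : ℝ) (c : ℕ) {θ : ℝ} (hθ : 0 ≤ θ) (hθ1 : θ < 1) :
    ¬ InjectedRate Cc c θ (fun _ j => 1 / ((j : ℝ) + 1) ^ 2) := by
  intro h
  -- eventually 2^{c+2}|C|·K^{c+2}θ^K < 1, and (K+1)^{c+2} ≤ 2^{c+2}K^{c+2} for K ≥ 1
  have ht : Tendsto (fun n : ℕ => 2 ^ (c + 2) * |Cc| * ((n : ℝ) ^ (c + 2) * θ ^ n)) atTop (𝓝 0) := by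
    have := (tendsto_pow_const_mul_const_pow_of_lt_one (c + 2) hθ hθ1).const_mul (2 ^ (c + 2) * |Cc|)
    simpa using this
  have hev : ∀ᶠ n : ℕ in atTop, 2 ^ (c + 2) * |Cc| * ((n : ℝ) ^ (c + 2) * θ ^ n) < 1 :=
    ht.eventually (gt_mem_nhds one_pos)
  obtain ⟨N, hN⟩ := eventually_atTop.mp hev
  have hKN : N ≤ max N 1 := le_max_left _ _
  have hK1 : 1 ≤ max N 1 := le_max_right _ _
  have hlt := hN _ hKN
  have hdiag := (h (max N 1) (max N 1) le_rfl).2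
  set K : ℕ := max N 1
  have hθK : 0 ≤ θ ^ K := pow_nonneg hθ K
  have hKr : (1 : ℝ) ≤ K := by exact_mod_cast hK1
  have hpos : 0 < ((K : ℝ) + 1) ^ 2 := by positivity
  have hpow : ((K : ℝ) + 1) ^ (c + 2) ≤ 2 ^ (c + 2) * (K : ℝ) ^ (c + 2) := by
    rw [← mul_pow]
    exact pow_le_pow_left₀ (by positivity) (by linarith) _
  -- from the diagonal inequality: 1 ≤ C (K+1)^c θ^K (K+1)^2 = C θ^K (K+1)^{c+2} ≤ |C| θ^K 2^{c+2} K^{c+2} < 1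
  have h1 : (1 : ℝ) ≤ Cc * ((K : ℝ) + 1) ^ c * θ ^ K * ((K : ℝ) + 1) ^ 2 := by
    have := (div_le_iff₀ hpos).mp hdiag
    simpa [one_mul] using this
  have h2 : Cc * ((K : ℝ) + 1) ^ c * θ ^ K * ((K : ℝ) + 1) ^ 2
      ≤ |Cc| * θ ^ K * (2 ^ (c + 2) * (K : ℝ) ^ (c + 2)) := by
    have e : Cc * ((K : ℝ) + 1) ^ c * θ ^ K * ((K : ℝ) + 1) ^ 2 = Cc * θ ^ K * ((K : ℝ) + 1) ^ (c + 2) := by ring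
    rw [e]
    exact mul_le_mul (mul_le_mul_of_nonneg_right (le_abs_self Cc) hθK) hpow (by positivity)
      (mul_nonneg (abs_nonneg _) hθK)
  have h3 : |Cc| * θ ^ K * (2 ^ (c + 2) * (K : ℝ) ^ (c + 2)) = 2 ^ (c + 2) * |Cc| * ((K : ℝ) ^ (c + 2) * θ ^ K) := by
    ring
  linarith [h3 ▸ h2]

/-- The witness injection of `not_injectedRate_of_witness` IS consumed by node U6: its transported totals are summable for every
`0 ≤ E`, `0 ≤ ρ < 1` (§3 with the profile `r_j = (j+1)⁻²`). [folklore] -/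
theorem summable_delta_witness {E ρ : ℝ} (hE : 0 ≤ E) (hρ : 0 ≤ ρ) (hρ1 : ρ < 1) :
    Summable (delta E ρ (fun _ j => 1 / ((j : ℝ) + 1) ^ 2)) := by
  have hps : Summable (fun n : ℕ => 1 / ((n : ℝ) + 1) ^ 2) := by
    have h1 := (summable_nat_add_iff 1).mpr (Real.summable_one_div_nat_pow.mpr (by norm_num : 1 < 2))
    exact h1.congr fun n => by push_cast; rfl
  exact summable_delta_of_scaleProfile hE hρ hρ1 (fun j => by positivity) hps fun K j _ => ⟨by positivity, le_rfl⟩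

end Summit.QuantumFields.BalabanUV.T4Continuum.NE9.SummableMemory
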